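import Mathlib.FieldTheory.Perfect
import Mathlib.RingTheory.RegularLocalRing.Defs
import Mathlib.RingTheory.Valuation.ValuationSubring
import Summits.ResolutionOfSingularities.ResolutionOfSingularities.Theorems.PAlterationPialtPowMemRange
import HarnessLib

/-!
# Crux `DualSandwich` (stmt-ResolutionOfSingularities-17083), line `birth`: stub `stub_relChain`

Route `ResolutionOfSingularities/FoliationDescent`, crux `DualSandwich`
(`FolLU → LogCanQuotLU → TorsorLUPerfect`), line `birth` of the lead's skeleton
(`--supports stmt-ResolutionOfSingularities-17083`; this file does not close the item).

**Statement (`stub_relChain`).** Fix a prime `p`. Assume the ONE-STEP RELATIVE DESCENT `h`: for all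
fields `k ⊆ K ⊆ L` with `k` perfect of characteristic `p` and `L / K` purely inseparable, generated
by one `y` with `y ^ p ∈ K`, every valuation ring `O` of `L`, every finitely generated
`k`-subalgebra `B ⊆ O` with `Frac B = L` which is regular at the centre of `O` (the localization
of `B` at the pull-back of the maximal ideal of `O` is a regular local ring) and every finitely
generated `k`-subalgebra `R ⊆ K` with `R ⊆ B`, there is a finitely generated `k`-subalgebra
`A ⊆ O ∩ K` of `K` with `R ⊆ A`, `Frac A = K`, regular at the centre of `O ∩ K`. Then the same
conclusion holds for every FINITE purely inseparable `L / K` (any degree).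

**Proof.** Induction on `d ≥ [L : K]` (`relChain_aux`), peeling from the bottom, exactly as in
`Theorems/PAlterationPialtSqueezeRRLU1.lean` (`isLocallyUniformizable_comap_of_rrLU1`). If
`K → L` is surjective, `h` applies with `y = 1`. Otherwise pick `y ∈ L ∖ K` with `y ^ p ∈ K`
(`exists_not_mem_range_pow_mem_range`), put `K₁ = K(y)`; by the tower law `[L : K₁] ≤ d`, so the
induction hypothesis applied to `K₁ ⊆ L` and `R₁ = R · K₁ ⊆ K₁` (the image of `R`) gives a
finitely generated `A₁ ⊆ O ∩ K₁` with `R₁ ⊆ A₁`, `Frac A₁ = K₁`, regular at the centre; then `h`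
applied to the height-one step `K ⊆ K₁ = K(y)` with the model `A₁` and the same `R` gives the
wanted `A ⊆ (O ∩ K₁) ∩ K = O ∩ K`. The same `R` is kept throughout; no regularity is transported
along ring isomorphisms (only an equality of valuation subrings is substituted).
-/

set_option linter.dupNamespace false -- single-problem summit: doubled namespace component is forced

noncomputable section

open IsLocalRing

namespace Summit.ResolutionOfSingularities.ResolutionOfSingularities.Theorems.DualSandwich.Birth

open Summit.ResolutionOfSingularities.ResolutionOfSingularities.Theorems.Pialt.RadiciallyRegular
  (exists_not_mem_range_pow_mem_range)

/-- Transport of the conclusion "some finitely generated `A ⊇ R` with `Frac A = K`, contained in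
the valuation ring and regular at its centre" along an EQUALITY of valuation subrings (by
substitution; no ring isomorphism is needed). [folklore] -/
theorem exists_model_congr_valuationSubring {k K : Type} [Field k] [Field K] [Algebra k K]
    (R : Subalgebra k K) {O₁ O₂ : ValuationSubring K} (e : O₁ = O₂)
    (h₁ : ∃ (A : Subalgebra k K) (hA : A.toSubring ≤ O₁.toSubring),
      R ≤ A ∧ A.FG ∧ IsFractionRing A K ∧
      IsRegularLocalRing (Localization.AtPrime
        (Ideal.comap (Subring.inclusion hA) (IsLocalRing.maximalIdeal O₁)))) :
    ∃ (A : Subalgebra k K) (hA : A.toSubring ≤ O₂.toSubring),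
      R ≤ A ∧ A.FG ∧ IsFractionRing A K ∧
      IsRegularLocalRing (Localization.AtPrime
        (Ideal.comap (Subring.inclusion hA) (IsLocalRing.maximalIdeal O₂))) := by
  subst e
  exact h₁

/-- **Relative descent along a finite purely inseparable extension, with a degree bound** (the
induction behind `stub_relChain`): under the one-step relative descent `h`, for every `d`, all
finite purely inseparable `L / K` with `[L : K] ≤ d` over a perfect field `k` of characteristic
`p`, every valuation ring `O` of `L`, every finitely generated `B ⊆ O` with `Frac B = L` regular
at the centre of `O`, and every finitely generated `R ⊆ K` with `R ⊆ B`, some finitely generated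
`A ⊆ O ∩ K` contains `R`, has `Frac A = K` and is regular at the centre of `O ∩ K`. Induction on
`d`: `K = L` is `h` with `y = 1`; otherwise peel `y ∈ L ∖ K` with `y ^ p ∈ K`
(`exists_not_mem_range_pow_mem_range`), descend `L / K(y)` by induction (`[L : K(y)] ≤ d` by the
tower law) with the image of `R` in `K(y)`, then `K(y) / K` by `h` with the same `R`.
[cite: Temkin2013, Thm. 1.3.2 and Rem. 1.3.5] -/
theorem relChain_aux (p : ℕ) (hp : p.Prime)
    (h : ∀ (k K L : Type) [Field k] [CharP k p] [PerfectField k] [Field K] [Field L] [Algebra k K]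
      [Algebra K L] [Algebra k L] [IsScalarTower k K L], IsPurelyInseparable K L →
      (∃ y : L, y ^ p ∈ (algebraMap K L).range ∧ IntermediateField.adjoin K {y} = ⊤) →
      ∀ (O : ValuationSubring L) (B : Subalgebra k L) (hB : B.toSubring ≤ O.toSubring)
        (R : Subalgebra k K), B.FG → IsFractionRing B L →
        IsRegularLocalRing (Localization.AtPrime
          (Ideal.comap (Subring.inclusion hB) (IsLocalRing.maximalIdeal O))) →
        R.FG → R.map (IsScalarTower.toAlgHom k K L) ≤ B →
        ∃ (A : Subalgebra k K) (hA : A.toSubring ≤ (O.comap (algebraMap K L)).toSubring),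
          R ≤ A ∧ A.FG ∧ IsFractionRing A K ∧
          IsRegularLocalRing (Localization.AtPrime
            (Ideal.comap (Subring.inclusion hA)
              (IsLocalRing.maximalIdeal (O.comap (algebraMap K L)))))) :
    ∀ (d : ℕ) (k K L : Type) [Field k] [CharP k p] [PerfectField k] [Field K] [Field L]
      [Algebra k K] [Algebra K L] [Algebra k L] [IsScalarTower k K L] [FiniteDimensional K L]
      [IsPurelyInseparable K L], Module.finrank K L ≤ d →
      ∀ (O : ValuationSubring L) (B : Subalgebra k L)
      (hB : B.toSubring ≤ O.toSubring) (R : Subalgebra k K), B.FG → IsFractionRing B L →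
      IsRegularLocalRing (Localization.AtPrime
        (Ideal.comap (Subring.inclusion hB) (IsLocalRing.maximalIdeal O))) →
      R.FG → R.map (IsScalarTower.toAlgHom k K L) ≤ B →
      ∃ (A : Subalgebra k K) (hA : A.toSubring ≤ (O.comap (algebraMap K L)).toSubring),
        R ≤ A ∧ A.FG ∧ IsFractionRing A K ∧
        IsRegularLocalRing (Localization.AtPrime
          (Ideal.comap (Subring.inclusion hA)
            (IsLocalRing.maximalIdeal (O.comap (algebraMap K L))))) := by
  intro d
  induction d with
  | zero =>
    intro k K L _ _ _ _ _ _ _ _ _ _ _ hd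
    exact absurd hd (not_le.mpr Module.finrank_pos)
  | succ d ih =>
    intro k K L _ _ _ _ _ _ _ _ _ _ _ hd O B hB R hBfg hBfr hBreg hRfg hRB
    by_cases hsurj : Function.Surjective (algebraMap K L)
    · -- `K = L`: the one-step descent with `y = 1`
      refine h k K L ‹_› ⟨1, ⟨1, by rw [one_pow, map_one]⟩, ?_⟩ O B hB R hBfg hBfr hBreg hRfg hRB
      refine eq_top_iff.mpr fun x _ => ?_
      obtain ⟨a, rfl⟩ := hsurj x
      exact IntermediateField.algebraMap_mem _ a
    · -- a height-one step `K ⊊ K₁ = K(y) ⊆ L`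
      haveI : Fact p.Prime := ⟨hp⟩
      haveI : CharP K p := charP_of_injective_algebraMap (algebraMap k K).injective p
      obtain ⟨y, hyK, hyp⟩ := exists_not_mem_range_pow_mem_range p K L hsurj
      set K₁ : IntermediateField K L := IntermediateField.adjoin K {y}
      haveI : FiniteDimensional (↥K₁) L := Module.Finite.of_restrictScalars_finite K _ _
      haveI : IsScalarTower k (↥K₁) L := IsScalarTower.of_algebraMap_eq fun _ => rfl
      -- `[L : K(y)] ≤ d` by the tower law
      have hK₁ne : K₁ ≠ ⊥ := by
        intro h
        apply hyK
        have hy : y ∈ K₁ := IntermediateField.mem_adjoin_simple_self K y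
        rw [h, IntermediateField.mem_bot] at hy
        obtain ⟨a, ha⟩ := hy
        exact ⟨a, ha⟩
      have h2 : 2 ≤ Module.finrank K ↥K₁ := by
        have hne1 : Module.finrank K ↥K₁ ≠ 1 := fun h =>
          hK₁ne (IntermediateField.finrank_eq_one_iff.mp h)
        have hpos : 0 < Module.finrank K ↥K₁ := Module.finrank_pos
        omega
      have htower : Module.finrank K ↥K₁ * Module.finrank (↥K₁) L = Module.finrank K L :=
        Module.finrank_mul_finrank K (↥K₁) L
      have hd₁ : Module.finrank (↥K₁) L ≤ d := by
        have hposL : 0 < Module.finrank (↥K₁) L := Module.finrank_pos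
        nlinarith [htower, h2, hd, hposL]
      -- the image `R₁` of `R` in `K₁` is finitely generated and still below `B`
      have hR₁B : (R.map (IsScalarTower.toAlgHom k K ↥K₁)).map (IsScalarTower.toAlgHom k (↥K₁) L)
          ≤ B := by
        rw [Subalgebra.map_map]
        rintro _ ⟨r, hr, rfl⟩
        exact hRB ⟨r, hr, IsScalarTower.algebraMap_apply K (↥K₁) L r⟩
      -- induction: descend `L / K₁` keeping `R₁`
      obtain ⟨A₁, hA₁, hRA₁, hA₁fg, hA₁fr, hA₁reg⟩ :=
        ih k (↥K₁) L hd₁ O B hB (R.map (IsScalarTower.toAlgHom k K ↥K₁)) hBfg hBfr hBreg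
          (hRfg.map _) hR₁B
      -- the one-step descent at the height-one step `K ⊆ K₁ = K(y)`, keeping `R`
      have hy₁ : ∃ y₁ : ↥K₁, y₁ ^ p ∈ (algebraMap K ↥K₁).range ∧
          IntermediateField.adjoin K {y₁} = ⊤ := by
        refine ⟨⟨y, IntermediateField.mem_adjoin_simple_self K y⟩, ?_, ?_⟩
        · obtain ⟨a, ha⟩ := hyp
          refine ⟨a, Subtype.ext ?_⟩
          rw [IntermediateField.coe_algebraMap_apply, ha]
          rfl
        · apply IntermediateField.lift_injective
          rw [IntermediateField.lift_adjoin_simple, IntermediateField.lift_top]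
      have key := h k K (↥K₁) inferInstance hy₁ (O.comap (algebraMap (↥K₁) L)) A₁ hA₁ R hA₁fg
        hA₁fr hA₁reg hRfg hRA₁
      -- `(O ∩ K₁) ∩ K = O ∩ K`
      refine exists_model_congr_valuationSubring R ?_ key
      rw [ValuationSubring.comap_comap, ← IsScalarTower.algebraMap_eq]

/-- **One-step relative descent ⇒ relative descent along every FINITE purely inseparable
extension `L / K`** (perfect ground field `k` of characteristic `p`; stub `stub_relChain` of line
`birth` of the crux `DualSandwich`): degree-`p` chains and induction on `[L : K]` — peel
`y ∈ L ∖ K` with `y ^ p ∈ K` from the bottom, descend `L / K(y)` by induction and `K(y) / K` by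
the step, keeping the same finitely generated `R ⊆ K` (`relChain_aux` at `d = [L : K]`).
[cite: Temkin2013, Thm. 1.3.2 and Rem. 1.3.5] -/
theorem stub_relChain (p : ℕ) (hp : p.Prime)
    (h : ∀ (k K L : Type) [Field k] [CharP k p] [PerfectField k] [Field K] [Field L] [Algebra k K]
      [Algebra K L] [Algebra k L] [IsScalarTower k K L], IsPurelyInseparable K L →
      (∃ y : L, y ^ p ∈ (algebraMap K L).range ∧ IntermediateField.adjoin K {y} = ⊤) →
      ∀ (O : ValuationSubring L) (B : Subalgebra k L) (hB : B.toSubring ≤ O.toSubring)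
        (R : Subalgebra k K), B.FG → IsFractionRing B L →
        IsRegularLocalRing (Localization.AtPrime
          (Ideal.comap (Subring.inclusion hB) (IsLocalRing.maximalIdeal O))) →
        R.FG → R.map (IsScalarTower.toAlgHom k K L) ≤ B →
        ∃ (A : Subalgebra k K) (hA : A.toSubring ≤ (O.comap (algebraMap K L)).toSubring),
          R ≤ A ∧ A.FG ∧ IsFractionRing A K ∧
          IsRegularLocalRing (Localization.AtPrime
            (Ideal.comap (Subring.inclusion hA)
              (IsLocalRing.maximalIdeal (O.comap (algebraMap K L)))))) :
    ∀ (k K L : Type) [Field k] [CharP k p] [PerfectField k] [Field K] [Field L] [Algebra k K]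
      [Algebra K L] [Algebra k L] [IsScalarTower k K L] [FiniteDimensional K L]
      [IsPurelyInseparable K L] (O : ValuationSubring L) (B : Subalgebra k L)
      (hB : B.toSubring ≤ O.toSubring) (R : Subalgebra k K), B.FG → IsFractionRing B L →
      IsRegularLocalRing (Localization.AtPrime
        (Ideal.comap (Subring.inclusion hB) (IsLocalRing.maximalIdeal O))) →
      R.FG → R.map (IsScalarTower.toAlgHom k K L) ≤ B →
      ∃ (A : Subalgebra k K) (hA : A.toSubring ≤ (O.comap (algebraMap K L)).toSubring),
        R ≤ A ∧ A.FG ∧ IsFractionRing A K ∧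
        IsRegularLocalRing (Localization.AtPrime
          (Ideal.comap (Subring.inclusion hA)
            (IsLocalRing.maximalIdeal (O.comap (algebraMap K L))))) :=
  fun k K L _ _ _ _ _ _ _ _ _ _ _ O B hB R hBfg hBfr hBreg hRfg hRB =>
    relChain_aux p hp h (Module.finrank K L) k K L le_rfl O B hB R hBfg hBfr hBreg hRfg hRB

end Summit.ResolutionOfSingularities.ResolutionOfSingularities.Theorems.DualSandwich.Birth

end
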